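import Summits.CriticalPhenomena.CardyFormulaZ2.Theorems.CardyIKTransportIKMixedBoxCrossingDefs2

/-!
# Stub `stub_polyDoubling` of the line `paired-mirror-exploration` (crux `IKMixedBoxCrossing`,
# stmt-CriticalPhenomena-5911)

The FKG-free POLYNOMIAL VERTICAL DOUBLING of the isotropic (`S = univ`) Izergin–Korepin gauge:
`pTB(w × (2h+1)) ≥ (9/25) · pTB(w × h)² / w²` for `w ≥ 2`, `h ≥ 1`, from the hypotheses `Mirror`
(reflection positivity of the gauge in the cell row `0` and its isotropic reading), `FiniteEnergy` and
`PatternLocality` (re-anchoring of boxes).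

PROOF.  Re-anchor the `w × h` box to `R = [0, w) × [1, h]` and the `w × (2h+1)` box to the band
`[0, w) × [-h, h]` (`univ_recentre`).  For `0 ≤ x < w` let `E_x` be the event "the cell `(x, 1)` is black
and joined inside `R` to the top row of `R` by a black path".  A bottom–top crossing of `R` (for `h ≥ 2`)
starts at a black cell `(x, 1)`, so by the union bound some `E_x` has probability `≥ pTB / w`; for `h = 1`,
`E_0 = {(0, 1) black}` has probability exactly `1/2 ≥ pTB / w` (the mirror `Θ₀` and the mirror-flip `Φ₀`
carry `{(0,1) black}` to `{(0,-1) black}` and to its complement).  `E_x` is measurable and determined by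
the cells and faces of `R` (rows `≥ 1`), so the mirror inequality gives
`μ(E_x ∩ Θ₀⁻¹ E_x) ≥ μ(E_x)²`, and `Θ₀⁻¹ E_x` is the reflected event (a black path inside the mirror image
`[0, w) × [-h, -1]` of `R` from its bottom row to `(x, -1)`: the open edge set of the reflected observables
is the `reflCell`-relabelling of the open edge set, `blackEdges_reflObs`).  Finite energy at the axis cell
`(x, 0)` (not read by `E_x ∩ Θ₀⁻¹ E_x`) makes it black at cost `9/25`, and the three black cells
`(x, 1), (x, 0), (x, -1)` glue the two paths into a bottom–top crossing of the band.  Elementary given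
the three hypotheses; no literature fact is used.
-/

noncomputable section

namespace Summit.CriticalPhenomena.CardyFormulaZ2.Cruxes.IKMixedBoxCrossing.PairedMirrorExploration

open MeasureTheory Set
open Literature.Probability.Percolation Literature.Probability.LatticeModels
open Summit.CriticalPhenomena.CardyFormulaZ2.Theorems.IKLinearTransport.PinnedDiagramExchange

namespace PolyDoublingStub

/-! ## §1 The reflections of cells and faces -/

/-- First coordinate of a reflected cell. [folklore] -/
@[simp] theorem reflCell_apply_zero (v : Site 2) : reflCell v 0 = v 0 := rfl

/-- Second coordinate of a reflected cell. [folklore] -/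
@[simp] theorem reflCell_apply_one (v : Site 2) : reflCell v 1 = -(v 1) := rfl

/-- First coordinate of a reflected face. [folklore] -/
@[simp] theorem reflFace_apply_zero (f : Site 2) : reflFace f 0 = f 0 := rfl

/-- Second coordinate of a reflected face. [folklore] -/
@[simp] theorem reflFace_apply_one (f : Site 2) : reflFace f 1 = -1 - f 1 := rfl

/-- `reflCell` is its own inverse (definitionally). [folklore] -/
theorem reflCell_symm : reflCell.symm = reflCell := rfl

/-- Equality of cells through their two coordinates. [folklore] -/
theorem vec2_eq_iff (p q : Site 2) : p = q ↔ p 0 = q 0 ∧ p 1 = q 1 :=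
  ⟨fun h => by rw [h]; exact ⟨rfl, rfl⟩, fun h => by ext i; fin_cases i; exacts [h.1, h.2]⟩

/-- The face read by the anti-diagonal at `p` reflects onto the cell label `reflCell p`. [folklore] -/
theorem reflFace_add_down (p : Site 2) : reflFace (p + ![0, -1]) = reflCell p := by
  rw [vec2_eq_iff, reflFace_apply_zero, reflFace_apply_one, reflCell_apply_zero, reflCell_apply_one]
  simp only [Pi.add_apply, Matrix.cons_val_zero, Matrix.cons_val_one]
  omega

/-- The face below the reflected cell is the reflected face. [folklore] -/
theorem reflCell_add_down (p : Site 2) : reflCell p + ![0, -1] = reflFace p := by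
  rw [vec2_eq_iff]
  simp only [reflFace_apply_zero, reflFace_apply_one, reflCell_apply_zero, reflCell_apply_one, Pi.add_apply,
    Matrix.cons_val_zero, Matrix.cons_val_one]
  omega

/-! ## §2 The open edge set of the reflected observables -/

/-- THE OPEN EDGE SET IS REFLECTED: with reflected black cells and reflected-and-flipped diagonal flags,
the open edges are the `reflCell`-images of the original ones (horizontal ↦ horizontal, vertical ↦
vertical, main ↔ anti diagonal; a sixteen-case check discharged by `grind`). [folklore] -/
theorem blackEdges_reflObs (x : Obs) :
    blackEdges (reflObs x) = BondConfig.relabel (sym2Equiv reflCell) (blackEdges x) := by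
  ext e
  induction e using Sym2.ind with
  | h p q =>
    rw [BondConfig.mem_relabel_iff, sym2Equiv_symm, reflCell_symm, sym2Equiv_mk,
      CouplingToLimits.mk_mem_blackEdges_iff, CouplingToLimits.mk_mem_blackEdges_iff]
    simp only [reflObs, mem_preimage, mem_compl_iff, not_not, reflFace_add_down, reflCell_add_down,
      vec2_eq_iff, Pi.add_apply, reflCell_apply_zero, reflCell_apply_one, Matrix.cons_val_zero,
      Matrix.cons_val_one]
    grind (splits := 40)

/-- Transport of black paths along the mirror: a black path of the reflected observables inside `S` is
a black path of the original observables inside the mirror image of `S`. [folklore] -/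
theorem reflObs_openConnIn {y : Obs} {S : Set (Site 2)} {u v : Site 2}
    (h : blackEdges (reflObs y) ∈ openConnIn S u v) :
    blackEdges y ∈ openConnIn (reflCell '' S) (reflCell u) (reflCell v) := by
  rw [blackEdges_reflObs] at h
  have h' := relabel_mem_openConnIn reflCell h
  have hinv := relabel_symm_relabel reflCell (blackEdges y)
  rw [reflCell_symm] at hinv
  rwa [hinv] at h'

/-! ## §3 Events determined by a set of cells and faces -/

/-- `determinedOn` is monotone in the set of cells/faces. [folklore] -/
theorem determinedOn_mono {Λ Λ' : Set (Site 2)} (h : Λ ⊆ Λ') : determinedOn Λ ⊆ determinedOn Λ' :=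
  fun _ hE x y hxy => hE x y fun v hv => hxy v (h hv)

/-- `determinedOn Λ` is closed under intersection. [folklore] -/
theorem inter_mem_determinedOn {Λ : Set (Site 2)} {E F : Set Obs} (hE : E ∈ determinedOn Λ)
    (hF : F ∈ determinedOn Λ) : E ∩ F ∈ determinedOn Λ :=
  fun x y hxy => and_congr (hE x y hxy) (hF x y hxy)

/-- The mirror image of an event determined by `Λ` is determined by the reflected cells and the
reflected faces of `Λ`. [folklore] -/
theorem reflObs_preimage_mem_determinedOn {Λ : Set (Site 2)} {E : Set Obs} (hE : E ∈ determinedOn Λ) :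
    reflObs ⁻¹' E ∈ determinedOn (reflCell '' Λ ∪ reflFace '' Λ) :=
  fun x y hxy => hE (reflObs x) (reflObs y) fun v hv =>
    ⟨(hxy (reflCell v) (Or.inl (mem_image_of_mem _ hv))).1,
      not_congr (hxy (reflFace v) (Or.inr (mem_image_of_mem _ hv))).2⟩

/-- An upper-half-plane event intersected with its mirror image does not read the axis cell `(x, 0)`.
[folklore] -/
theorem inter_reflObs_mem_determinedOn {E : Set Obs} (hE : UpperDet E) (x : ℤ) :
    E ∩ reflObs ⁻¹' E ∈ determinedOn {u : Site 2 | u ≠ ![x, 0]} := by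
  obtain ⟨Λ, hΛ, hEΛ⟩ := hE
  refine inter_mem_determinedOn (determinedOn_mono (fun v hv => ?_) hEΛ)
    (determinedOn_mono (fun v hv => ?_) (reflObs_preimage_mem_determinedOn hEΛ))
  · exact fun h => absurd (hΛ v hv) (by rw [h]; simp)
  · rcases hv with ⟨u, hu, rfl⟩ | ⟨u, hu, rfl⟩
    · refine fun h => absurd (hΛ u hu) ?_
      have h1 := congrFun h 1
      simp only [reflCell_apply_one, Matrix.cons_val_one, Matrix.cons_val_zero] at h1
      omega
    · refine fun h => absurd (hΛ u hu) ?_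
      have h1 := congrFun h 1
      simp only [reflFace_apply_one, Matrix.cons_val_one, Matrix.cons_val_zero] at h1
      omega

/-- Open crossings inside `X` only read the edges with both ends in `X`
(copied from the wave-1 file `StubPatternLocality.lean`). [folklore] -/
theorem mem_openCrossing_congr {V : Type*} {ξ ξ' : BondConfig V} {X A B : Set V}
    (h : ∀ u ∈ X, ∀ v ∈ X, (s(u, v) ∈ ξ ↔ s(u, v) ∈ ξ')) :
    ξ ∈ openCrossing X A B ↔ ξ' ∈ openCrossing X A B := by
  have hG : (openGraph ξ).induce X = (openGraph ξ').induce X := by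
    ext p q
    simp only [SimpleGraph.induce_adj, openGraph_adj, h p.1 p.2 q.1 q.2]
  simp only [mem_openCrossing_iff, openConnIn, Set.mem_setOf_eq, hG]

/-- Membership of an edge in the open edge set only reads its two end cells and the (at most one) face
its diagonal condition refers to. [folklore] -/
theorem mk_mem_blackEdges_congr {x y : Obs} {u v : Site 2} (h1 : u ∈ x.1 ↔ u ∈ y.1)
    (h2 : v ∈ x.1 ↔ v ∈ y.1) (h3 : v = u + ![1, 1] → (u ∈ x.2 ↔ u ∈ y.2))
    (h4 : v = u + ![1, -1] → (u + ![0, -1] ∈ x.2 ↔ u + ![0, -1] ∈ y.2))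
    (h5 : u = v + ![1, 1] → (v ∈ x.2 ↔ v ∈ y.2))
    (h6 : u = v + ![1, -1] → (v + ![0, -1] ∈ x.2 ↔ v + ![0, -1] ∈ y.2)) :
    s(u, v) ∈ blackEdges x ↔ s(u, v) ∈ blackEdges y := by
  rw [CouplingToLimits.mk_mem_blackEdges_iff, CouplingToLimits.mk_mem_blackEdges_iff, h1, h2]
  exact or_congr
    (and_congr_right fun _ => and_congr_right fun _ => or_congr_right <| or_congr_right <|
      or_congr (and_congr_right fun h => not_congr (h3 h)) (and_congr_right fun h => h4 h))
    (and_congr_right fun _ => and_congr_right fun _ => or_congr_right <| or_congr_right <|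
      or_congr (and_congr_right fun h => not_congr (h5 h)) (and_congr_right fun h => h6 h))

/-! ## §4 The arrival events `E_x` -/

/-- The mirror on observables is measurable. [folklore] -/
theorem measurable_reflObs : Measurable reflObs :=
  (measurable_set_iff.2 fun v => (measurable_set_mem (reflCell v)).comp measurable_fst).prodMk
    (measurable_set_iff.2 fun f => ((measurable_set_mem (reflFace f)).comp measurable_snd).not)

/-- The arrival event `E_x` ("`(x, 1)` is black and joined inside `R = [0,w) × [1,h]` to the top row of `R`")
is measurable. [folklore] -/
theorem measurableSet_arrival (w h : ℕ) (x : ℤ) :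
    MeasurableSet {y : Obs | (![x, 1] : Site 2) ∈ y.1 ∧
      blackEdges y ∈ openCrossing (band w h ∩ {v | 1 ≤ v 1}) {![x, 1]} (bandTop w h)} :=
  (measurableSet_setOf.2 ((measurable_set_mem _).comp measurable_fst)).inter
    (CouplingToLimits.measurable_blackEdges (measurableSet_openCrossing_of_countable _ _ _))

/-- The arrival event `E_x` is determined by the cells and faces of `R` (all in rows `≥ 1`). [folklore] -/
theorem upperDet_arrival {w h : ℕ} {x : ℤ} (hh : 1 ≤ h) (hx0 : 0 ≤ x) (hxw : x < w) :
    UpperDet {y : Obs | (![x, 1] : Site 2) ∈ y.1 ∧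
      blackEdges y ∈ openCrossing (band w h ∩ {v | 1 ≤ v 1}) {![x, 1]} (bandTop w h)} := by
  refine ⟨Finset.Icc ![0, 1] ![(w : ℤ) - 1, (h : ℤ)], fun v hv => ?_, fun X Y hXY => ?_⟩
  · rw [Finset.mem_Icc, Pi.le_def, Pi.le_def] at hv
    have := hv.1 1
    simpa only [Matrix.cons_val_one, Matrix.cons_val_zero] using this
  · have hmem : ∀ v : Site 2, 0 ≤ v 0 → v 0 < w → 1 ≤ v 1 → v 1 ≤ h →
        v ∈ (↑(Finset.Icc ![(0 : ℤ), 1] ![(w : ℤ) - 1, (h : ℤ)]) : Set (Site 2)) := by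
      intro v h0 h0' h1 h1'
      rw [Finset.mem_coe, Finset.mem_Icc, Pi.le_def, Pi.le_def, Fin.forall_fin_two, Fin.forall_fin_two]
      simp only [Matrix.cons_val_zero, Matrix.cons_val_one]
      omega
    have hR : ∀ u ∈ band w h ∩ {v : Site 2 | 1 ≤ v 1}, 0 ≤ u 0 ∧ u 0 < w ∧ 1 ≤ u 1 ∧ u 1 ≤ h := by
      intro u hu
      simp only [band, mem_inter_iff, mem_setOf_eq] at hu
      omega
    refine and_congr (hXY _ (hmem _ (by simpa using hx0) (by simpa using hxw) (by simp) (by simpa using hh))).1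
      (mem_openCrossing_congr fun u hu v hv => ?_)
    obtain ⟨hu0, hu0', hu1, hu1'⟩ := hR u hu
    obtain ⟨hv0, hv0', hv1, hv1'⟩ := hR v hv
    refine mk_mem_blackEdges_congr (hXY u (hmem u hu0 hu0' hu1 hu1')).1 (hXY v (hmem v hv0 hv0' hv1 hv1')).1
      (fun _ => (hXY u (hmem u hu0 hu0' hu1 hu1')).2) (fun huv => (hXY _ (hmem _ ?_ ?_ ?_ ?_)).2)
      (fun _ => (hXY v (hmem v hv0 hv0' hv1 hv1')).2) (fun huv => (hXY _ (hmem _ ?_ ?_ ?_ ?_)).2)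
    all_goals
      first
      | (have e0 := congrFun huv 0; have e1 := congrFun huv 1
         simp only [Pi.add_apply, Matrix.cons_val_zero, Matrix.cons_val_one] at e0 e1 ⊢
         omega)

/-! ## §5 Paths: black endpoints, the union bound, the glue -/

/-- The source of a nondegenerate black path is black. [folklore] -/
theorem fst_mem_of_openConnIn {y : Obs} {S : Set (Site 2)} {u v : Site 2}
    (h : blackEdges y ∈ openConnIn S u v) (huv : u ≠ v) : u ∈ y.1 := by
  obtain ⟨l, hhead, -, -, hblack, -⟩ := CouplingToLimits.exists_chain_of_mem_openConnIn h huv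
  exact hblack u (List.mem_of_mem_head? (by rw [hhead]; exact Option.mem_some_self u))

/-- UNION BOUND INCLUSION (`h ≥ 2`): a bottom–top crossing of `R = [0,w) × [1,h]` starts at a black cell
`(x, 1)`, `0 ≤ x < w`, joined inside `R` to the top row: it lies in some arrival event `E_x`. [folklore] -/
theorem tbCross_subset_iUnion_arrival {w h : ℕ} (hh : 2 ≤ h) :
    tbCross 0 1 w h ⊆ ⋃ x ∈ Finset.range w, {y : Obs | (![(x : ℤ), 1] : Site 2) ∈ y.1 ∧
      blackEdges y ∈ openCrossing (band w h ∩ {v | 1 ≤ v 1}) {![(x : ℤ), 1]} (bandTop w h)} := by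
  rintro y ⟨s, hs, t, ht, hst⟩
  simp only [mem_setOf_eq] at hs ht
  have hs' : s = ![((s 0).toNat : ℤ), 1] := by
    rw [vec2_eq_iff]; simp only [Matrix.cons_val_zero, Matrix.cons_val_one]; omega
  have hne : s ≠ t := fun hst => by have := congrFun hst 1; omega
  refine mem_iUnion₂.2 ⟨(s 0).toNat, Finset.mem_range.2 (by omega), ?_, ?_⟩
  · rw [← hs']
    exact fst_mem_of_openConnIn hst hne
  · refine ⟨s, by rw [← hs']; exact mem_singleton s, t, ?_, openConnIn_mono (fun v hv => ?_) _ _ hst⟩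
    · simp only [bandTop, mem_setOf_eq]; omega
    · simp only [band, mem_inter_iff, mem_setOf_eq] at hv ⊢; omega

/-- THE GLUE: a black path inside `R` from the top row to the black cell `(x, 1)`, its mirror image (a
black path inside the mirror image of `R` from the bottom row of the band to the black cell `(x, -1)`) and
the black axis cell `(x, 0)` form a bottom–top crossing of the band `[0, w) × [-h, h]`. [folklore] -/
theorem glue {y : Obs} {w h : ℕ} {x : ℤ} (hh : 1 ≤ h) (hx0 : 0 ≤ x) (hxw : x < w)
    (h1 : y ∈ {y : Obs | (![x, 1] : Site 2) ∈ y.1 ∧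
      blackEdges y ∈ openCrossing (band w h ∩ {v | 1 ≤ v 1}) {![x, 1]} (bandTop w h)})
    (h2 : reflObs y ∈ {y : Obs | (![x, 1] : Site 2) ∈ y.1 ∧
      blackEdges y ∈ openCrossing (band w h ∩ {v | 1 ≤ v 1}) {![x, 1]} (bandTop w h)})
    (h0 : (![x, 0] : Site 2) ∈ y.1) : y ∈ tbCross 0 (-(h : ℤ)) w (2 * h + 1) := by
  obtain ⟨hb1, s, hs, t, ht, hst⟩ := h1
  obtain ⟨hb2, s', hs', t', ht', hst'⟩ := h2
  rw [mem_singleton_iff] at hs hs'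
  subst hs hs'
  have hr1 : reflCell ![x, 1] = ![x, -1] := by ext i; fin_cases i <;> rfl
  replace hb2 : (![x, -1] : Site 2) ∈ y.1 := by
    rw [← hr1]; exact hb2
  have hlow := reflObs_openConnIn hst'
  rw [hr1] at hlow
  simp only [bandTop, mem_setOf_eq] at ht ht'
  have hloB : reflCell '' (band w h ∩ {v : Site 2 | 1 ≤ v 1}) ⊆ band w h := by
    rintro _ ⟨v, hv, rfl⟩
    simp only [band, mem_inter_iff, mem_setOf_eq, reflCell_apply_zero, reflCell_apply_one] at hv ⊢
    omega
  have hx1B : (![x, 1] : Site 2) ∈ band w h := by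
    simp only [band, mem_setOf_eq, Matrix.cons_val_zero, Matrix.cons_val_one]; omega
  have hx0B : (![x, 0] : Site 2) ∈ band w h := by
    simp only [band, mem_setOf_eq, Matrix.cons_val_zero, Matrix.cons_val_one]; omega
  have hxmB : (![x, -1] : Site 2) ∈ band w h := by
    simp only [band, mem_setOf_eq, Matrix.cons_val_zero, Matrix.cons_val_one]; omega
  have e1 : s(![x, 0], ![x, 1]) ∈ blackEdges y :=
    (CouplingToLimits.mk_mem_blackEdges_iff _ _ _).2 (Or.inl ⟨h0, hb1, Or.inr (Or.inl (by
      ext i; fin_cases i <;> simp))⟩)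
  have e2 : s(![x, -1], ![x, 0]) ∈ blackEdges y :=
    (CouplingToLimits.mk_mem_blackEdges_iff _ _ _).2 (Or.inl ⟨hb2, h0, Or.inr (Or.inl (by
      ext i; fin_cases i <;> simp))⟩)
  have ne1 : (![x, 0] : Site 2) ≠ ![x, 1] := by rw [Ne, vec2_eq_iff]; simp
  have ne2 : (![x, -1] : Site 2) ≠ ![x, 0] := by rw [Ne, vec2_eq_iff]; simp
  have c1 : blackEdges y ∈ openConnIn (band w h) (reflCell t') ![x, -1] := by
    rw [openConnIn_comm]; exact openConnIn_mono hloB _ _ hlow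
  have c2 : blackEdges y ∈ openConnIn (band w h) ![x, -1] ![x, 0] := openConnIn_of_adj hxmB hx0B e2 ne2
  have c3 : blackEdges y ∈ openConnIn (band w h) ![x, 0] ![x, 1] := openConnIn_of_adj hx0B hx1B e1 ne1
  have c4 : blackEdges y ∈ openConnIn (band w h) ![x, 1] t := openConnIn_mono inter_subset_left _ _ hst
  refine ⟨reflCell t', ?_, t, ?_, openConnIn_mono (fun v hv => ?_) _ _
    (PlanarDuality.openConnIn_trans (PlanarDuality.openConnIn_trans c1 c2)
      (PlanarDuality.openConnIn_trans c3 c4))⟩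
  · simp only [mem_setOf_eq, reflCell_apply_zero, reflCell_apply_one]; omega
  · simp only [mem_setOf_eq]; push_cast; omega
  · simp only [band, mem_setOf_eq] at hv ⊢; push_cast; omega

/-! ## §6 Probability: the colour of one cell, the mirror-gluing step -/

/-- Under the mirror hypotheses every cell is black with probability exactly `1/2`: `Θ₀` carries
`{v black}` to `{reflCell v black}` and `Φ₀` carries it to the complement of the latter. [folklore] -/
theorem real_black_eq_half (hM : Mirror) (v : Site 2) :
    μIK.real {ω | v ∈ blackSet Set.univ ω} = 1 / 2 := by
  haveI := CouplingToLimits.isProbabilityMeasure_μIK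
  obtain ⟨hΘ, hΦ, hobsΘ, hobsΦ, -⟩ := hM
  have hmeas : ∀ u : Site 2, MeasurableSet {ω : Ω | u ∈ blackSet Set.univ ω} := fun u =>
    measurableSet_setOf.2 (CouplingToLimits.measurable_mem_blackSet _ _)
  have h1 : Θ₀ ⁻¹' {ω | v ∈ blackSet Set.univ ω} = {ω | reflCell v ∈ blackSet Set.univ ω} := by
    ext ω
    simp only [mem_preimage, mem_setOf_eq, show blackSet Set.univ (Θ₀ ω) = (reflObs (obs Set.univ ω)).1
      from congrArg Prod.fst (hobsΘ ω), reflObs, obs]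
  have h2 : Φ₀ ⁻¹' {ω | v ∈ blackSet Set.univ ω} = {ω | reflCell v ∈ blackSet Set.univ ω}ᶜ := by
    ext ω
    simp only [mem_preimage, mem_setOf_eq, show blackSet Set.univ (Φ₀ ω) = _
      from congrArg Prod.fst (hobsΦ ω), reflObs, complObs, obs, mem_compl_iff]
  have e1 := hΘ.measureReal_preimage (hmeas v).nullMeasurableSet
  have e2 := hΦ.measureReal_preimage (hmeas v).nullMeasurableSet
  rw [h1] at e1
  rw [h2, probReal_compl_eq_one_sub (hmeas _)] at e2
  linarith

/-- THE MIRROR-GLUING STEP: for a measurable upper-half-plane event `E`,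
`(9/25) μ(E)² ≤ μ(E ∩ mirror image of E ∩ {(x, 0) black})` (mirror inequality, then finite energy at the
axis cell, which `E` and its mirror image do not read). [folklore] -/
theorem sq_le_real_glued (hM : Mirror) (hF : FiniteEnergy) {E : Set Obs} (hEm : MeasurableSet E)
    (hEu : UpperDet E) (x : ℤ) :
    (9 / 25 : ℝ) * μIK.real (obs Set.univ ⁻¹' E) ^ 2 ≤
      μIK.real (obs Set.univ ⁻¹' (E ∩ reflObs ⁻¹' E) ∩ {ω | (![x, 0] : Site 2) ∈ blackSet Set.univ ω}) := by
  obtain ⟨-, -, hobsΘ, -, hRP⟩ := hM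
  have h1 := (hRP Set.univ E hEm hEu).1
  have hset : obs Set.univ ⁻¹' E ∩ Θ₀ ⁻¹' (obs Set.univ ⁻¹' E) = obs Set.univ ⁻¹' (E ∩ reflObs ⁻¹' E) := by
    ext ω; simp only [mem_inter_iff, mem_preimage, hobsΘ]
  rw [hset] at h1
  have h2 := hF Set.univ ![x, 0] (E ∩ reflObs ⁻¹' E) (hEm.inter (measurable_reflObs hEm))
    (inter_reflObs_mem_determinedOn hEu x)
  linarith [mul_le_mul_of_nonneg_left h1 (by norm_num : (0 : ℝ) ≤ 9 / 25)]

/-- SOME ARRIVAL CELL IS LIKELY: there is `0 ≤ x < w` with `μ(E_x) ≥ pTB(R) / w` (union bound over the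
`w` possible starting cells for `h ≥ 2`; for `h = 1` the box crossing is degenerate and `E_0 ⊇ {(0,1) black}`
has probability `1/2 ≥ 1/w`). [folklore] -/
theorem exists_arrival_ge (hM : Mirror) {w h : ℕ} (hw : 2 ≤ w) (hh : 1 ≤ h) :
    ∃ x : ℤ, 0 ≤ x ∧ x < w ∧ pTB Set.univ 0 1 w h / w ≤
      μIK.real (obs Set.univ ⁻¹' {y : Obs | (![x, 1] : Site 2) ∈ y.1 ∧
        blackEdges y ∈ openCrossing (band w h ∩ {v | 1 ≤ v 1}) {![x, 1]} (bandTop w h)}) := by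
  haveI := CouplingToLimits.isProbabilityMeasure_μIK
  have hw0 : (0 : ℝ) < w := by exact_mod_cast (show 0 < w by omega)
  rcases Nat.lt_or_ge h 2 with hlt | hge
  · -- `h = 1`: the arrival event at `x = 0` contains `{(0, 1) black}`
    have h1 : h = 1 := by omega
    subst h1
    refine ⟨0, le_rfl, by exact_mod_cast (show 0 < w by omega), ?_⟩
    have hsub : {ω : Ω | (![(0 : ℤ), 1] : Site 2) ∈ blackSet Set.univ ω} ⊆
        obs Set.univ ⁻¹' {y : Obs | (![(0 : ℤ), 1] : Site 2) ∈ y.1 ∧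
          blackEdges y ∈ openCrossing (band w 1 ∩ {v | 1 ≤ v 1}) {![(0 : ℤ), 1]} (bandTop w 1)} := by
      intro ω hω
      have hmem : (![(0 : ℤ), 1] : Site 2) ∈ band w 1 ∩ {v : Site 2 | 1 ≤ v 1} := by
        simp only [band, mem_inter_iff, mem_setOf_eq, Matrix.cons_val_zero, Matrix.cons_val_one, Nat.cast_one]
        omega
      refine ⟨hω, ![0, 1], mem_singleton _, ![0, 1], ?_, openConnIn_refl hmem⟩
      simp only [bandTop, mem_setOf_eq, Matrix.cons_val_zero, Matrix.cons_val_one, Nat.cast_one, true_and]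
      omega
    have hle : pTB Set.univ 0 1 w 1 / w ≤ 1 / 2 := by
      rw [div_le_iff₀ hw0]
      have hp : pTB Set.univ 0 1 w 1 ≤ 1 := measureReal_le_one
      have hw2 : (2 : ℝ) ≤ w := by exact_mod_cast hw
      linarith
    exact hle.trans ((real_black_eq_half hM _).symm.le.trans (measureReal_mono hsub (measure_ne_top _ _)))
  · -- `h ≥ 2`: union bound
    set F : ℕ → Set Obs := fun i => {y : Obs | (![(i : ℤ), 1] : Site 2) ∈ y.1 ∧
      blackEdges y ∈ openCrossing (band w h ∩ {v | 1 ≤ v 1}) {![(i : ℤ), 1]} (bandTop w h)}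
    have hU : tbCross 0 1 w h ⊆ ⋃ i ∈ Finset.range w, F i := tbCross_subset_iUnion_arrival hge
    have hsum : pTB Set.univ 0 1 w h ≤ ∑ i ∈ Finset.range w, μIK.real (obs Set.univ ⁻¹' F i) :=
      calc pTB Set.univ 0 1 w h = μIK.real (obs Set.univ ⁻¹' tbCross 0 1 w h) := rfl
        _ ≤ μIK.real (obs Set.univ ⁻¹' ⋃ i ∈ Finset.range w, F i) :=
          measureReal_mono (preimage_mono hU) (measure_ne_top _ _)
        _ = μIK.real (⋃ i ∈ Finset.range w, obs Set.univ ⁻¹' F i) := by rw [preimage_iUnion₂]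
        _ ≤ ∑ i ∈ Finset.range w, μIK.real (obs Set.univ ⁻¹' F i) := measureReal_biUnion_finset_le _ _
    have hne : (Finset.range w).Nonempty := Finset.nonempty_range_iff.2 (by omega)
    have hconst : ∑ _i ∈ Finset.range w, pTB Set.univ 0 1 w h / w = pTB Set.univ 0 1 w h := by
      rw [Finset.sum_const, Finset.card_range, nsmul_eq_mul]
      field_simp
    rw [← hconst] at hsum
    obtain ⟨i, hi, hle⟩ := Finset.exists_le_of_sum_le hne hsum
    exact ⟨i, by positivity, by exact_mod_cast Finset.mem_range.1 hi, hle⟩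

end PolyDoublingStub

open PolyDoublingStub in
/-- **Stub `stub_polyDoubling`** (line `paired-mirror-exploration`, crux stmt-CriticalPhenomena-5911): the
FKG-free polynomial vertical doubling of the isotropic gauge,
`(9/25) · pTB(w × h)² / w² ≤ pTB(w × (2h+1))` for `w ≥ 2`, `h ≥ 1`, from `Mirror`, `FiniteEnergy` and
`PatternLocality`. [folklore] -/
theorem stub_polyDoubling : PolyDoubling := by
  intro hM hF hL w h hw hh
  haveI := CouplingToLimits.isProbabilityMeasure_μIK
  rw [← (univ_recentre hL 0 1 w h).2, ← (univ_recentre hL 0 (-(h : ℤ)) w (2 * h + 1)).2]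
  obtain ⟨x, hx0, hxw, hpx⟩ := exists_arrival_ge hM hw hh
  have hsq := sq_le_real_glued hM hF (measurableSet_arrival w h x) (upperDet_arrival hh hx0 hxw) x
  have hw0 : (0 : ℝ) < w := by exact_mod_cast (show 0 < w by omega)
  have hp0 : 0 ≤ pTB Set.univ 0 1 w h := measureReal_nonneg
  calc (9 / 25 : ℝ) * pTB Set.univ 0 1 w h ^ 2 / (w : ℝ) ^ 2
      = 9 / 25 * (pTB Set.univ 0 1 w h / w) ^ 2 := by rw [div_pow]; ring
    _ ≤ 9 / 25 * μIK.real (obs Set.univ ⁻¹' {y : Obs | (![x, 1] : Site 2) ∈ y.1 ∧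
          blackEdges y ∈ openCrossing (band w h ∩ {v | 1 ≤ v 1}) {![x, 1]} (bandTop w h)}) ^ 2 :=
        mul_le_mul_of_nonneg_left (pow_le_pow_left₀ (div_nonneg hp0 hw0.le) hpx 2) (by norm_num)
    _ ≤ _ := hsq
    _ ≤ μIK.real (obs Set.univ ⁻¹' tbCross 0 (-(h : ℤ)) w (2 * h + 1)) :=
        measureReal_mono (fun ω hω => glue hh hx0 hxw hω.1.1 hω.1.2 hω.2) (measure_ne_top μIK _)

end Summit.CriticalPhenomena.CardyFormulaZ2.Cruxes.IKMixedBoxCrossing.PairedMirrorExploration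

end
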